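import Summits.CriticalPhenomena.PercolationContinuityZ3.Theorems.Transplant.FKThreeApexT3Envelope
import HarnessLib

/-!
# The three-apex monoid: the frontier form `vForm` along the `Z₁`-fibre (towards `EnvelopeA q` for all `q`)

Helper file (`--supports stmt-CriticalPhenomena-4575`), FK sub-lane `prim-bschramm-fk-3` (gen 17); builds on p205010 (kernel theorem,
internal audit signed; external expert review pending).  No sorries; standard axioms.  Memo `bschramm/prim-bschramm-fk-3/T3-FIBRE.md`.

The frontier form `vForm q θ θ' Z` (file `…T3Envelope`) is AFFINE in the full-merge mass `Z.z1` when the other four fibre masses are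
fixed (every environment form is affine in the total mass `v̂`).  This file records

* `vSlope` — the `Z₁`-slope, an explicit polynomial in the hat coordinates, and the identity `vForm_eq_affine`;
* `vForm_z1_zero_nonneg` — at the LOWER end of the fibre (`Z₁ = 0`) the frontier form is non-negative for all `θ, θ' ≥ 0`,
  `0 ≤ q ≤ 1`, whenever `Z_ab, Z_ac ≥ 0`, `Z₀ ≥ 0` and `Z_ac ≤ Z_bc`: it is a square plus a polynomial with non-negative coefficients in
  `(Z₀, Z_ab, Z_ac, Z_bc − Z_ac, θ, θ', q, 1−q)` (`vloRest`, 221 terms, found by a Bernstein expansion in `q`);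
* hence `vForm_nonneg_of_vSlope_nonneg` — wherever the slope is `≥ 0`, `vForm ≥ 0` follows from `Z.Nonneg` alone (the case `Z_bc ≤ Z_ac`
  is the `a ↔ b` mirror image, `vForm_swapAB`).

The complementary case (negative slope: the upper end of the fibre, cut out by the cap `capA` and the harmonic-weight instance of `(U_a)`)
is the subject of the companion files. [folklore]
-/

noncomputable section

namespace Summit.CriticalPhenomena.PercolationContinuityZ3.Theorems

namespace FK

namespace ThreeApex

/-! ### The `Z₁`-slope of the frontier form -/

/-- The `Z₁`-slope of `vForm q θ θ' Z` (every environment form is affine in `v̂ = Z.total`; these are the slopes of the nine entries of the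
`3 × 3` coefficient matrix of `V(θ,θ')`, in hat coordinates `û, x̂, ŷ, ẑ`). [folklore] -/
def vSlope (q θ θ' : ℝ) (Z : V5) : ℝ :=
  (hx Z - (2 - q) * Z.z0)
  + θ' * ((hx Z - (2 - q) * Z.z0) + (hz Z - (2 - q) * Z.z0) - (1 - q) * (hx Z + hz Z - (2 - q) * Z.z0))
  + θ' ^ 2 * (hz Z - (2 - q) * Z.z0)
  + θ * ((hx Z - (2 - q) * Z.z0) + (hy Z - (2 - q) * Z.z0) - (1 - q) * (hx Z + hy Z - (2 - q) * Z.z0))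
  + θ * θ' * ((hy Z + hz Z - (2 - q) * Z.z0) - (hx Z + hz Z - (2 - q) * Z.z0) - (hx Z + hy Z - (2 - q) * Z.z0)
      + 2 * (hx Z - (2 - q) * Z.z0) + 2 * q * (hy Z + hz Z - (2 - q) * Z.z0) + q ^ 2 * (hx Z + hy Z + hz Z - (2 - q) * Z.z0))
  + θ * θ' ^ 2 * ((hy Z + hz Z - (2 - q) * Z.z0) + (hz Z - (2 - q) * Z.z0) + q * (hy Z + hz Z - (2 - q) * Z.z0) - (hy Z - (2 - q) * Z.z0))
  + θ ^ 2 * (hy Z - (2 - q) * Z.z0)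
  + θ ^ 2 * θ' * ((hy Z + hz Z - (2 - q) * Z.z0) + (hy Z - (2 - q) * Z.z0) + q * (hy Z + hz Z - (2 - q) * Z.z0) - (hz Z - (2 - q) * Z.z0))
  + θ ^ 2 * θ' ^ 2 * (hy Z + hz Z - (2 - q) * Z.z0)

/-- The environment with the full-merge mass removed (`Z₁ := 0`): the lower end of the `Z₁`-fibre. [folklore] -/
def dropTop (Z : V5) : V5 := ⟨Z.z0, Z.zab, Z.zac, Z.zbc, 0⟩

/-- **The frontier form is affine along the `Z₁`-fibre**: `V(Z) = V(Z with Z₁ = 0) + Z₁ · vSlope`. [folklore] -/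
theorem vForm_eq_affine (q θ θ' : ℝ) (Z : V5) :
    vForm q θ θ' Z = vForm q θ θ' (dropTop Z) + Z.z1 * vSlope q θ θ' Z := by
  simp only [vForm, envForm, vSlope, dropTop, eAA, eBB, eCC, nAB, nAC, nBC, pAB, pAC, pBC, pTop, hx, hy, hz, V5.total]
  ring

/-! ### The lower end of the fibre -/

set_option maxRecDepth 4000 in
/-- Block 1/5 of the lower-end remainder polynomial (non-negative integer coefficients; `r` stands for `1 − q`). [folklore] -/
def vloRest1 (_u _a b d q r t s : ℝ) : ℝ :=
    q * r ^ (2 : ℕ) * d ^ (2 : ℕ) * s + (2:ℝ) * q ^ (2 : ℕ) * r * d ^ (2 : ℕ) * s + q ^ (3 : ℕ) * d ^ (2 : ℕ) * s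
    + r ^ (3 : ℕ) * d ^ (2 : ℕ) * s ^ (2 : ℕ) + (3:ℝ) * q * r ^ (2 : ℕ) * d ^ (2 : ℕ) * s ^ (2 : ℕ) + (3:ℝ) * q ^ (2 : ℕ) * r * d ^ (2 : ℕ) * s ^ (2 : ℕ)
    + q ^ (3 : ℕ) * d ^ (2 : ℕ) * s ^ (2 : ℕ) + (2:ℝ) * q * r ^ (2 : ℕ) * d ^ (2 : ℕ) * t * s + (5:ℝ) * q ^ (2 : ℕ) * r * d ^ (2 : ℕ) * t * s
    + (3:ℝ) * q ^ (3 : ℕ) * d ^ (2 : ℕ) * t * s + (2:ℝ) * r ^ (3 : ℕ) * d ^ (2 : ℕ) * t * s ^ (2 : ℕ) + (7:ℝ) * q * r ^ (2 : ℕ) * d ^ (2 : ℕ) * t * s ^ (2 : ℕ)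
    + (8:ℝ) * q ^ (2 : ℕ) * r * d ^ (2 : ℕ) * t * s ^ (2 : ℕ) + (3:ℝ) * q ^ (3 : ℕ) * d ^ (2 : ℕ) * t * s ^ (2 : ℕ) + q * r ^ (2 : ℕ) * d ^ (2 : ℕ) * t ^ (2 : ℕ) * s
    + (2:ℝ) * q ^ (2 : ℕ) * r * d ^ (2 : ℕ) * t ^ (2 : ℕ) * s + q ^ (3 : ℕ) * d ^ (2 : ℕ) * t ^ (2 : ℕ) * s + r ^ (3 : ℕ) * d ^ (2 : ℕ) * t ^ (2 : ℕ) * s ^ (2 : ℕ)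
    + (3:ℝ) * q * r ^ (2 : ℕ) * d ^ (2 : ℕ) * t ^ (2 : ℕ) * s ^ (2 : ℕ) + (3:ℝ) * q ^ (2 : ℕ) * r * d ^ (2 : ℕ) * t ^ (2 : ℕ) * s ^ (2 : ℕ) + q ^ (3 : ℕ) * d ^ (2 : ℕ) * t ^ (2 : ℕ) * s ^ (2 : ℕ)
    + r ^ (3 : ℕ) * b * d + (2:ℝ) * q * r ^ (2 : ℕ) * b * d + q ^ (2 : ℕ) * r * b * d
    + (2:ℝ) * r ^ (3 : ℕ) * b * d * s + (7:ℝ) * q * r ^ (2 : ℕ) * b * d * s + (8:ℝ) * q ^ (2 : ℕ) * r * b * d * s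
    + (3:ℝ) * q ^ (3 : ℕ) * b * d * s + (3:ℝ) * r ^ (3 : ℕ) * b * d * s ^ (2 : ℕ) + (9:ℝ) * q * r ^ (2 : ℕ) * b * d * s ^ (2 : ℕ)
    + (9:ℝ) * q ^ (2 : ℕ) * r * b * d * s ^ (2 : ℕ) + (3:ℝ) * q ^ (3 : ℕ) * b * d * s ^ (2 : ℕ) + (2:ℝ) * r ^ (3 : ℕ) * b * d * t
    + (5:ℝ) * q * r ^ (2 : ℕ) * b * d * t + (4:ℝ) * q ^ (2 : ℕ) * r * b * d * t + q ^ (3 : ℕ) * b * d * t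
    + (4:ℝ) * r ^ (3 : ℕ) * b * d * t * s + (16:ℝ) * q * r ^ (2 : ℕ) * b * d * t * s + (24:ℝ) * q ^ (2 : ℕ) * r * b * d * t * s
    + (12:ℝ) * q ^ (3 : ℕ) * b * d * t * s + (6:ℝ) * r ^ (3 : ℕ) * b * d * t * s ^ (2 : ℕ) + (22:ℝ) * q * r ^ (2 : ℕ) * b * d * t * s ^ (2 : ℕ)
    + (26:ℝ) * q ^ (2 : ℕ) * r * b * d * t * s ^ (2 : ℕ) + (10:ℝ) * q ^ (3 : ℕ) * b * d * t * s ^ (2 : ℕ) + r ^ (3 : ℕ) * b * d * t ^ (2 : ℕ)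

set_option maxRecDepth 4000 in
/-- Block 2/5 of the lower-end remainder polynomial (non-negative integer coefficients; `r` stands for `1 − q`). [folklore] -/
def vloRest2 (_u _a b d q r t s : ℝ) : ℝ :=
    (3:ℝ) * q * r ^ (2 : ℕ) * b * d * t ^ (2 : ℕ) + (3:ℝ) * q ^ (2 : ℕ) * r * b * d * t ^ (2 : ℕ) + q ^ (3 : ℕ) * b * d * t ^ (2 : ℕ)
    + (2:ℝ) * r ^ (3 : ℕ) * b * d * t ^ (2 : ℕ) * s + (10:ℝ) * q * r ^ (2 : ℕ) * b * d * t ^ (2 : ℕ) * s + (14:ℝ) * q ^ (2 : ℕ) * r * b * d * t ^ (2 : ℕ) * s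
    + (6:ℝ) * q ^ (3 : ℕ) * b * d * t ^ (2 : ℕ) * s + (4:ℝ) * r ^ (3 : ℕ) * b * d * t ^ (2 : ℕ) * s ^ (2 : ℕ) + (12:ℝ) * q * r ^ (2 : ℕ) * b * d * t ^ (2 : ℕ) * s ^ (2 : ℕ)
    + (12:ℝ) * q ^ (2 : ℕ) * r * b * d * t ^ (2 : ℕ) * s ^ (2 : ℕ) + (4:ℝ) * q ^ (3 : ℕ) * b * d * t ^ (2 : ℕ) * s ^ (2 : ℕ) + r ^ (3 : ℕ) * b ^ (2 : ℕ)
    + (2:ℝ) * q * r ^ (2 : ℕ) * b ^ (2 : ℕ) + q ^ (2 : ℕ) * r * b ^ (2 : ℕ) + (2:ℝ) * r ^ (3 : ℕ) * b ^ (2 : ℕ) * s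
    + (6:ℝ) * q * r ^ (2 : ℕ) * b ^ (2 : ℕ) * s + (6:ℝ) * q ^ (2 : ℕ) * r * b ^ (2 : ℕ) * s + (2:ℝ) * q ^ (3 : ℕ) * b ^ (2 : ℕ) * s
    + (2:ℝ) * r ^ (3 : ℕ) * b ^ (2 : ℕ) * s ^ (2 : ℕ) + (6:ℝ) * q * r ^ (2 : ℕ) * b ^ (2 : ℕ) * s ^ (2 : ℕ) + (6:ℝ) * q ^ (2 : ℕ) * r * b ^ (2 : ℕ) * s ^ (2 : ℕ)
    + (2:ℝ) * q ^ (3 : ℕ) * b ^ (2 : ℕ) * s ^ (2 : ℕ) + (2:ℝ) * r ^ (3 : ℕ) * b ^ (2 : ℕ) * t + (6:ℝ) * q * r ^ (2 : ℕ) * b ^ (2 : ℕ) * t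
    + (6:ℝ) * q ^ (2 : ℕ) * r * b ^ (2 : ℕ) * t + (2:ℝ) * q ^ (3 : ℕ) * b ^ (2 : ℕ) * t + (4:ℝ) * r ^ (3 : ℕ) * b ^ (2 : ℕ) * t * s
    + (16:ℝ) * q * r ^ (2 : ℕ) * b ^ (2 : ℕ) * t * s + (24:ℝ) * q ^ (2 : ℕ) * r * b ^ (2 : ℕ) * t * s + (12:ℝ) * q ^ (3 : ℕ) * b ^ (2 : ℕ) * t * s
    + (4:ℝ) * r ^ (3 : ℕ) * b ^ (2 : ℕ) * t * s ^ (2 : ℕ) + (16:ℝ) * q * r ^ (2 : ℕ) * b ^ (2 : ℕ) * t * s ^ (2 : ℕ) + (20:ℝ) * q ^ (2 : ℕ) * r * b ^ (2 : ℕ) * t * s ^ (2 : ℕ)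
    + (8:ℝ) * q ^ (3 : ℕ) * b ^ (2 : ℕ) * t * s ^ (2 : ℕ) + (2:ℝ) * r ^ (3 : ℕ) * b ^ (2 : ℕ) * t ^ (2 : ℕ) + (6:ℝ) * q * r ^ (2 : ℕ) * b ^ (2 : ℕ) * t ^ (2 : ℕ)
    + (6:ℝ) * q ^ (2 : ℕ) * r * b ^ (2 : ℕ) * t ^ (2 : ℕ) + (2:ℝ) * q ^ (3 : ℕ) * b ^ (2 : ℕ) * t ^ (2 : ℕ) + (4:ℝ) * r ^ (3 : ℕ) * b ^ (2 : ℕ) * t ^ (2 : ℕ) * s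
    + (16:ℝ) * q * r ^ (2 : ℕ) * b ^ (2 : ℕ) * t ^ (2 : ℕ) * s + (20:ℝ) * q ^ (2 : ℕ) * r * b ^ (2 : ℕ) * t ^ (2 : ℕ) * s + (8:ℝ) * q ^ (3 : ℕ) * b ^ (2 : ℕ) * t ^ (2 : ℕ) * s
    + (4:ℝ) * r ^ (3 : ℕ) * b ^ (2 : ℕ) * t ^ (2 : ℕ) * s ^ (2 : ℕ) + (12:ℝ) * q * r ^ (2 : ℕ) * b ^ (2 : ℕ) * t ^ (2 : ℕ) * s ^ (2 : ℕ) + (12:ℝ) * q ^ (2 : ℕ) * r * b ^ (2 : ℕ) * t ^ (2 : ℕ) * s ^ (2 : ℕ)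

set_option maxRecDepth 4000 in
/-- Block 3/5 of the lower-end remainder polynomial (non-negative integer coefficients; `r` stands for `1 − q`). [folklore] -/
def vloRest3 (_u a b d q r t s : ℝ) : ℝ :=
    (4:ℝ) * q ^ (3 : ℕ) * b ^ (2 : ℕ) * t ^ (2 : ℕ) * s ^ (2 : ℕ) + r ^ (3 : ℕ) * a * d + (3:ℝ) * q * r ^ (2 : ℕ) * a * d
    + (3:ℝ) * q ^ (2 : ℕ) * r * a * d + q ^ (3 : ℕ) * a * d + (2:ℝ) * q * r ^ (2 : ℕ) * a * d * s
    + (4:ℝ) * q ^ (2 : ℕ) * r * a * d * s + (2:ℝ) * q ^ (3 : ℕ) * a * d * s + r ^ (3 : ℕ) * a * d * s ^ (2 : ℕ)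
    + (3:ℝ) * q * r ^ (2 : ℕ) * a * d * s ^ (2 : ℕ) + (3:ℝ) * q ^ (2 : ℕ) * r * a * d * s ^ (2 : ℕ) + q ^ (3 : ℕ) * a * d * s ^ (2 : ℕ)
    + (2:ℝ) * r ^ (3 : ℕ) * a * d * t + (5:ℝ) * q * r ^ (2 : ℕ) * a * d * t + (4:ℝ) * q ^ (2 : ℕ) * r * a * d * t
    + q ^ (3 : ℕ) * a * d * t + (2:ℝ) * q * r ^ (2 : ℕ) * a * d * t * s + (6:ℝ) * q ^ (2 : ℕ) * r * a * d * t * s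
    + (4:ℝ) * q ^ (3 : ℕ) * a * d * t * s + (3:ℝ) * q * r ^ (2 : ℕ) * a * d * t * s ^ (2 : ℕ) + (6:ℝ) * q ^ (2 : ℕ) * r * a * d * t * s ^ (2 : ℕ)
    + (3:ℝ) * q ^ (3 : ℕ) * a * d * t * s ^ (2 : ℕ) + r ^ (3 : ℕ) * a * d * t ^ (2 : ℕ) + (2:ℝ) * q * r ^ (2 : ℕ) * a * d * t ^ (2 : ℕ)
    + q ^ (2 : ℕ) * r * a * d * t ^ (2 : ℕ) + q * r ^ (2 : ℕ) * a * d * t ^ (2 : ℕ) * s + (2:ℝ) * q ^ (2 : ℕ) * r * a * d * t ^ (2 : ℕ) * s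
    + q ^ (3 : ℕ) * a * d * t ^ (2 : ℕ) * s + q * r ^ (2 : ℕ) * a * d * t ^ (2 : ℕ) * s ^ (2 : ℕ) + (2:ℝ) * q ^ (2 : ℕ) * r * a * d * t ^ (2 : ℕ) * s ^ (2 : ℕ)
    + q ^ (3 : ℕ) * a * d * t ^ (2 : ℕ) * s ^ (2 : ℕ) + (2:ℝ) * r ^ (3 : ℕ) * a * b + (6:ℝ) * q * r ^ (2 : ℕ) * a * b
    + (6:ℝ) * q ^ (2 : ℕ) * r * a * b + (2:ℝ) * q ^ (3 : ℕ) * a * b + (2:ℝ) * r ^ (3 : ℕ) * a * b * s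
    + (7:ℝ) * q * r ^ (2 : ℕ) * a * b * s + (8:ℝ) * q ^ (2 : ℕ) * r * a * b * s + (3:ℝ) * q ^ (3 : ℕ) * a * b * s
    + (2:ℝ) * r ^ (3 : ℕ) * a * b * s ^ (2 : ℕ) + (5:ℝ) * q * r ^ (2 : ℕ) * a * b * s ^ (2 : ℕ) + (4:ℝ) * q ^ (2 : ℕ) * r * a * b * s ^ (2 : ℕ)
    + q ^ (3 : ℕ) * a * b * s ^ (2 : ℕ) + (2:ℝ) * r ^ (3 : ℕ) * a * b * t + (7:ℝ) * q * r ^ (2 : ℕ) * a * b * t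

set_option maxRecDepth 4000 in
/-- Block 4/5 of the lower-end remainder polynomial (non-negative integer coefficients; `r` stands for `1 − q`). [folklore] -/
def vloRest4 (u a b d q r t s : ℝ) : ℝ :=
    (8:ℝ) * q ^ (2 : ℕ) * r * a * b * t + (3:ℝ) * q ^ (3 : ℕ) * a * b * t + (4:ℝ) * q * r ^ (2 : ℕ) * a * b * t * s
    + (12:ℝ) * q ^ (2 : ℕ) * r * a * b * t * s + (8:ℝ) * q ^ (3 : ℕ) * a * b * t * s + (4:ℝ) * q * r ^ (2 : ℕ) * a * b * t * s ^ (2 : ℕ)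
    + (8:ℝ) * q ^ (2 : ℕ) * r * a * b * t * s ^ (2 : ℕ) + (4:ℝ) * q ^ (3 : ℕ) * a * b * t * s ^ (2 : ℕ) + (2:ℝ) * r ^ (3 : ℕ) * a * b * t ^ (2 : ℕ)
    + (5:ℝ) * q * r ^ (2 : ℕ) * a * b * t ^ (2 : ℕ) + (4:ℝ) * q ^ (2 : ℕ) * r * a * b * t ^ (2 : ℕ) + q ^ (3 : ℕ) * a * b * t ^ (2 : ℕ)
    + (4:ℝ) * q * r ^ (2 : ℕ) * a * b * t ^ (2 : ℕ) * s + (8:ℝ) * q ^ (2 : ℕ) * r * a * b * t ^ (2 : ℕ) * s + (4:ℝ) * q ^ (3 : ℕ) * a * b * t ^ (2 : ℕ) * s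
    + (2:ℝ) * q * r ^ (2 : ℕ) * a * b * t ^ (2 : ℕ) * s ^ (2 : ℕ) + (4:ℝ) * q ^ (2 : ℕ) * r * a * b * t ^ (2 : ℕ) * s ^ (2 : ℕ) + (2:ℝ) * q ^ (3 : ℕ) * a * b * t ^ (2 : ℕ) * s ^ (2 : ℕ)
    + q * r ^ (2 : ℕ) * a ^ (2 : ℕ) * s + (2:ℝ) * q ^ (2 : ℕ) * r * a ^ (2 : ℕ) * s + q ^ (3 : ℕ) * a ^ (2 : ℕ) * s
    + q * r ^ (2 : ℕ) * a ^ (2 : ℕ) * t + (2:ℝ) * q ^ (2 : ℕ) * r * a ^ (2 : ℕ) * t + q ^ (3 : ℕ) * a ^ (2 : ℕ) * t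
    + q ^ (2 : ℕ) * r * a ^ (2 : ℕ) * t * s + q ^ (3 : ℕ) * a ^ (2 : ℕ) * t * s + q ^ (2 : ℕ) * r * u * d * s
    + q ^ (3 : ℕ) * u * d * s + q * r ^ (2 : ℕ) * u * d * s ^ (2 : ℕ) + (2:ℝ) * q ^ (2 : ℕ) * r * u * d * s ^ (2 : ℕ)
    + q ^ (3 : ℕ) * u * d * s ^ (2 : ℕ) + (2:ℝ) * q * r ^ (2 : ℕ) * u * d * t * s + (7:ℝ) * q ^ (2 : ℕ) * r * u * d * t * s
    + (6:ℝ) * q ^ (3 : ℕ) * u * d * t * s + (4:ℝ) * q * r ^ (2 : ℕ) * u * d * t * s ^ (2 : ℕ) + (9:ℝ) * q ^ (2 : ℕ) * r * u * d * t * s ^ (2 : ℕ)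
    + (5:ℝ) * q ^ (3 : ℕ) * u * d * t * s ^ (2 : ℕ) + (2:ℝ) * q * r ^ (2 : ℕ) * u * d * t ^ (2 : ℕ) * s + (5:ℝ) * q ^ (2 : ℕ) * r * u * d * t ^ (2 : ℕ) * s
    + (3:ℝ) * q ^ (3 : ℕ) * u * d * t ^ (2 : ℕ) * s + (2:ℝ) * q * r ^ (2 : ℕ) * u * d * t ^ (2 : ℕ) * s ^ (2 : ℕ) + (4:ℝ) * q ^ (2 : ℕ) * r * u * d * t ^ (2 : ℕ) * s ^ (2 : ℕ)
    + (2:ℝ) * q ^ (3 : ℕ) * u * d * t ^ (2 : ℕ) * s ^ (2 : ℕ) + q ^ (2 : ℕ) * r * u * b * s + q ^ (3 : ℕ) * u * b * s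

set_option maxRecDepth 4000 in
/-- Block 5/5 of the lower-end remainder polynomial (non-negative integer coefficients; `r` stands for `1 − q`). [folklore] -/
def vloRest5 (u a b _d q r t s : ℝ) : ℝ :=
    q * r ^ (2 : ℕ) * u * b * s ^ (2 : ℕ) + (2:ℝ) * q ^ (2 : ℕ) * r * u * b * s ^ (2 : ℕ) + q ^ (3 : ℕ) * u * b * s ^ (2 : ℕ)
    + q ^ (2 : ℕ) * r * u * b * t + q ^ (3 : ℕ) * u * b * t + (4:ℝ) * q * r ^ (2 : ℕ) * u * b * t * s
    + (14:ℝ) * q ^ (2 : ℕ) * r * u * b * t * s + (12:ℝ) * q ^ (3 : ℕ) * u * b * t * s + (6:ℝ) * q * r ^ (2 : ℕ) * u * b * t * s ^ (2 : ℕ)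
    + (14:ℝ) * q ^ (2 : ℕ) * r * u * b * t * s ^ (2 : ℕ) + (8:ℝ) * q ^ (3 : ℕ) * u * b * t * s ^ (2 : ℕ) + q * r ^ (2 : ℕ) * u * b * t ^ (2 : ℕ)
    + (2:ℝ) * q ^ (2 : ℕ) * r * u * b * t ^ (2 : ℕ) + q ^ (3 : ℕ) * u * b * t ^ (2 : ℕ) + (6:ℝ) * q * r ^ (2 : ℕ) * u * b * t ^ (2 : ℕ) * s
    + (14:ℝ) * q ^ (2 : ℕ) * r * u * b * t ^ (2 : ℕ) * s + (8:ℝ) * q ^ (3 : ℕ) * u * b * t ^ (2 : ℕ) * s + (4:ℝ) * q * r ^ (2 : ℕ) * u * b * t ^ (2 : ℕ) * s ^ (2 : ℕ)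
    + (8:ℝ) * q ^ (2 : ℕ) * r * u * b * t ^ (2 : ℕ) * s ^ (2 : ℕ) + (4:ℝ) * q ^ (3 : ℕ) * u * b * t ^ (2 : ℕ) * s ^ (2 : ℕ) + q * r ^ (2 : ℕ) * u * a
    + (2:ℝ) * q ^ (2 : ℕ) * r * u * a + q ^ (3 : ℕ) * u * a + q ^ (2 : ℕ) * r * u * a * s
    + q ^ (3 : ℕ) * u * a * s + q ^ (2 : ℕ) * r * u * a * t + q ^ (3 : ℕ) * u * a * t
    + (5:ℝ) * q ^ (2 : ℕ) * r * u * a * t * s + (6:ℝ) * q ^ (3 : ℕ) * u * a * t * s + (2:ℝ) * q ^ (2 : ℕ) * r * u * a * t * s ^ (2 : ℕ)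
    + (2:ℝ) * q ^ (3 : ℕ) * u * a * t * s ^ (2 : ℕ) + (2:ℝ) * q ^ (2 : ℕ) * r * u * a * t ^ (2 : ℕ) * s + (2:ℝ) * q ^ (3 : ℕ) * u * a * t ^ (2 : ℕ) * s
    + q ^ (2 : ℕ) * r * u * a * t ^ (2 : ℕ) * s ^ (2 : ℕ) + q ^ (3 : ℕ) * u * a * t ^ (2 : ℕ) * s ^ (2 : ℕ) + (2:ℝ) * q ^ (2 : ℕ) * r * u ^ (2 : ℕ) * t * s
    + (3:ℝ) * q ^ (3 : ℕ) * u ^ (2 : ℕ) * t * s + (2:ℝ) * q ^ (2 : ℕ) * r * u ^ (2 : ℕ) * t * s ^ (2 : ℕ) + (2:ℝ) * q ^ (3 : ℕ) * u ^ (2 : ℕ) * t * s ^ (2 : ℕ)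
    + (2:ℝ) * q ^ (2 : ℕ) * r * u ^ (2 : ℕ) * t ^ (2 : ℕ) * s + (2:ℝ) * q ^ (3 : ℕ) * u ^ (2 : ℕ) * t ^ (2 : ℕ) * s

/-- The remainder polynomial of the lower-end value: `V(θ,θ'; ⟨u, a, b, b+d, 0⟩) − (a − q θ θ' u)²`, with non-negative integer
coefficients in `u, a, b, d, θ, θ', q, r` (`r` stands for `1 − q`; Bernstein degree `3` in `q`; 221 terms in 5 blocks). [folklore] -/
def vloRest (u a b d q r t s : ℝ) : ℝ := vloRest1 u a b d q r t s + vloRest2 u a b d q r t s + vloRest3 u a b d q r t s + vloRest4 u a b d q r t s + vloRest5 u a b d q r t s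

set_option maxHeartbeats 4000000 in
/-- **The lower-end identity**: for `Z = ⟨u, a, b, b + d, 0⟩`,
`vForm q θ θ' Z = (a − q θ θ' u)² + vloRest u a b d q (1−q) θ θ'`. [folklore] -/
theorem vForm_z1_zero_eq (q θ θ' u a b d : ℝ) :
    vForm q θ θ' ⟨u, a, b, b + d, 0⟩ = (a - q * θ * θ' * u) ^ 2 + vloRest u a b d q (1 - q) θ θ' := by
  simp only [vForm, envForm, vloRest, vloRest1, vloRest2, vloRest3, vloRest4, vloRest5, eAA, eBB, eCC, nAB, nAC, nBC, pAB, pAC, pBC, pTop, hx, hy, hz, V5.total]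
  ring

/-- The remainder polynomial is non-negative on the orthant. [folklore] -/
theorem vloRest_nonneg {u a b d q r t s : ℝ} (hu : 0 ≤ u) (ha : 0 ≤ a) (hb : 0 ≤ b) (hd : 0 ≤ d) (hq : 0 ≤ q) (hr : 0 ≤ r)
    (ht : 0 ≤ t) (hs : 0 ≤ s) : 0 ≤ vloRest u a b d q r t s := by
  unfold vloRest vloRest1 vloRest2 vloRest3 vloRest4 vloRest5
  positivity

/-- **Lower end of the fibre**: if `Z₀, Z_ab, Z_ac ≥ 0`, `Z_ac ≤ Z_bc` and `Z₁ = 0`, then `vForm q θ θ' Z ≥ 0` for all `θ, θ' ≥ 0`,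
`0 ≤ q ≤ 1`. [folklore] -/
theorem vForm_z1_zero_nonneg {q θ θ' : ℝ} (hq0 : 0 ≤ q) (hq1 : q ≤ 1) (hθ : 0 ≤ θ) (hθ' : 0 ≤ θ') {Z : V5}
    (h0 : 0 ≤ Z.z0) (hab : 0 ≤ Z.zab) (hac : 0 ≤ Z.zac) (hle : Z.zac ≤ Z.zbc) :
    0 ≤ vForm q θ θ' (dropTop Z) := by
  have e : dropTop Z = ⟨Z.z0, Z.zab, Z.zac, Z.zac + (Z.zbc - Z.zac), 0⟩ := by
    simp only [dropTop]; congr 1; ring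
  rw [e, vForm_z1_zero_eq]
  have h1 : 0 ≤ vloRest Z.z0 Z.zab Z.zac (Z.zbc - Z.zac) q (1 - q) θ θ' :=
    vloRest_nonneg h0 hab hac (sub_nonneg.2 hle) hq0 (sub_nonneg.2 hq1) hθ hθ'
  nlinarith [sq_nonneg (Z.zab - q * θ * θ' * Z.z0)]

/-- **Non-negative slope ⇒ `vForm ≥ 0`** (case `Z_ac ≤ Z_bc`): from the fibre masses being non-negative alone. [folklore] -/
theorem vForm_nonneg_of_vSlope_nonneg {q θ θ' : ℝ} (hq0 : 0 ≤ q) (hq1 : q ≤ 1) (hθ : 0 ≤ θ) (hθ' : 0 ≤ θ') {Z : V5}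
    (hZ : Z.Nonneg) (hle : Z.zac ≤ Z.zbc) (hsl : 0 ≤ vSlope q θ θ' Z) : 0 ≤ vForm q θ θ' Z := by
  rw [vForm_eq_affine]
  exact add_nonneg (vForm_z1_zero_nonneg hq0 hq1 hθ hθ' hZ.h0 hZ.hab hZ.hac hle) (mul_nonneg hZ.h1 hsl)

/-! ### The `a ↔ b` mirror symmetry of the frontier form -/

/-- `V(θ, θ'; Z) = V(θ', θ; swapAB Z)`: the frontier form is symmetric under the relabelling `a ↔ b` together with `θ ↔ θ'`. [folklore] -/
theorem vForm_swapAB (q θ θ' : ℝ) (Z : V5) : vForm q θ θ' Z = vForm q θ' θ (swapAB Z) := by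
  simp only [vForm, envForm, swapAB, eAA, eBB, eCC, nAB, nAC, nBC, pAB, pAC, pBC, pTop, hx, hy, hz, V5.total]
  ring

/-- The slope transforms the same way. [folklore] -/
theorem vSlope_swapAB (q θ θ' : ℝ) (Z : V5) : vSlope q θ θ' Z = vSlope q θ' θ (swapAB Z) := by
  simp only [vSlope, swapAB, hx, hy, hz]
  ring

/-- **Non-negative slope ⇒ `vForm ≥ 0`**, both orderings of `Z_ac, Z_bc`. [folklore] -/
theorem vForm_nonneg_of_vSlope_nonneg' {q θ θ' : ℝ} (hq0 : 0 ≤ q) (hq1 : q ≤ 1) (hθ : 0 ≤ θ) (hθ' : 0 ≤ θ') {Z : V5}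
    (hZ : Z.Nonneg) (hsl : 0 ≤ vSlope q θ θ' Z) : 0 ≤ vForm q θ θ' Z := by
  rcases le_total Z.zac Z.zbc with hle | hle
  · exact vForm_nonneg_of_vSlope_nonneg hq0 hq1 hθ hθ' hZ hle hsl
  · rw [vForm_swapAB]
    rw [vSlope_swapAB] at hsl
    exact vForm_nonneg_of_vSlope_nonneg hq0 hq1 hθ' hθ ⟨hZ.h0, hZ.hab, hZ.hbc, hZ.hac, hZ.h1⟩ hle hsl

end ThreeApex

end FK

end Summit.CriticalPhenomena.PercolationContinuityZ3.Theorems
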